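import Literature.NumberTheory.EllipticCurves.SigmaSqDivisionOfThetaProofs
import Literature.NumberTheory.EllipticCurves.PadicSigmaSq
import Literature.NumberTheory.EllipticCurves.PadicSigmaOfZetaProofs
import Literature.NumberTheory.EllipticCurves.PadicSigmaVariableChangeProofs
import Literature.NumberTheory.EllipticCurves.FormalGroupShortModelParityProofs
import Literature.NumberTheory.EllipticCurves.FormalMulTwoSecondCoeffProofs
import HarnessLib

/-!
# The two characterisations of the squared Mazur–Tate sigma function agree (Mazur–Tate 1991,
# Thm. 3.1), and the sigma-squared pair EXISTS UNIQUELY at a good ordinary `p = 2` — proofs only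

Trunk T-NT-EC (`Literature/NumberTheory/EllipticCurves`). Pure proof file (no definitions, no named
facts, net literature debt `0`), sequel of `SigmaSqDivisionOfThetaProofs.lean` and companion of
`PadicSigmaSq.lean` (receptacle `IsMazurTateSigmaSqPair`: `Σ = z² + ⋯ ∈ z²ℤ_p⟦z⟧` even, squared
Mazur–Stein–Tate equation `2(x + c) = -D(DΣ/Σ)`) and `PadicSigmaSqDivisionTwo.lean` (named fact
`mazurTate_sigmaSq_existsUnique_two` = Silverman, Math. Ann. 332 (2005) §5 Rem. 2: at a good ordinary `2`
there is a unique `σ² ∈ z² + z³ℤ₂⟦z⟧` with `σ²(nQ) = σ(Q)^{2n²}F_n²(Q)`, `IsSigmaSqDivisionSeries`).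
Typer seat `bsd-goldfeld-ty` g9 of the cell `bsd-goldfeld` (memo `TY-HYPOTHESES-AT-TWO.md` §10.5 R1b,
referee G42/G3b), in support of stmt-BirchSwinnertonDyer-19141 (LTYZ 2025 Thm. 1.1 at `p = 2`).

## Main results

For a `p`-integral elliptic curve `V/ℚ_p`, ANY prime `p`:

* `IsSigmaSqDivisionSeries.exists_isMazurTateSigmaSqPair` — **division polynomials ⟹ differential
  equation**: a sigma-squared division series `Σ` is a sigma-squared pair `(Σ, c)` for some `c ∈ ℚ_p`
  (in fact the squared DUPLICATION identity `σ²(2Q) = σ(Q)⁸F₂²(Q)` alone suffices,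
  `exists_isMazurTateSigmaSqPair_of_sigmaSqDivisionIdentity_two`);
* `IsMazurTateSigmaSqPair.isSigmaSqDivisionSeries` — **differential equation ⟹ division polynomials**:
  a sigma-squared pair satisfies all squared `n`-division identities;
* at `p = 2`, for `W/ℚ` globally minimal with good ORDINARY reduction at `2`, UNDER the printed fact
  `mazurTate_sigmaSq_existsUnique_two`: `exists_isMazurTateSigmaSqPair_two` (the receptacle is
  inhabited — contrast `not_exists_isMazurTateSigmaPair_two_of_norm_a₁_eq_one`),
  `existsUnique_isMazurTateSigmaSqPair_two` (`∃!`), `isMazurTateSigmaSqPair_padicSigmaSq_two` and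
  `isSigmaSqDivisionSeries_padicSigmaSq_two` (**THE squared pair `(padicSigmaSq, padicSigmaSqConst)` of
  `W ⊗ ℚ₂` is a genuine sigma-squared pair and IS Silverman's `σ²`**, so `canonicalPAdicHeightSq W 2`
  is not pinned to the junk branch), `IsSigmaSqDivisionSeries.eq_padicSigmaSq_two`.

So Mazur–Tate's Thm. 3.1 at `p = 2` holds in the tree in BOTH currencies modulo the one printed
statement, and every `p = 2` height fact typed over `IsCanonicalSq` (ruling: never over `IsCanonical`)
speaks about the Mazur–Tate `σ²`.

## The proof

* §1 `exists_isFormallyOdd_satisfiesSigmaODE` — on every `V/ℚ_p` the sigma equation has a normalised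
  odd FORMAL solution for some constant: Blakestad–Grant's `σ' = z·exp∫(Λω - 1)/z` (`sigmaOfZeta`) on
  the model `toCharNeTwoNF • V` (`a₁ = a₃ = 0`) for an even zeta series `Λ`, `zΛ' - Λ = -Xω` (`β = 0`;
  formally exact over a field: `exists_padicWeierstrassZetaSeries`, `zetaSeries_sub_C_mul_X`,
  `rescale_neg_one_eq_self_of_zetaSeries`), odd by `isFormallyOdd_sigmaOfZeta`, transported back by
  `IsFormallyOdd.variableChange_subst` / `SatisfiesSigmaODE.variableChange_subst`.
* §2 calculus of `D = d/ω`: `D(f∘[n]) = n·(Df)∘[n]` (`formalInvariantDerivation_subst_formalMul`, from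
  `ω([n])·[n]' = nω`); `Df = 0 ⇒ f` constant; `h∘[2] = h ⇒ h` constant (lowest coefficient:
  `[z^k]h([2]z) = 2^k[z^k]h`); the Wronskian lemma `Df·g = f·Dg`, `g(0) = 1 ⇒ f = f(0)·g`;
  `D exp(ε log_W²) = 2ε log_W exp(ε log_W²)` and its evenness.
* §3 `SatisfiesSigmaODE.mul_exp_subst` — the one-parameter family of formal solutions:
  `(σ·e^{ε log_W²}, c - 2ε)` is again a normalised odd solution (`N(fg) = N(f)g² + f²N(g)`).
* §4 rigidity (`exists_eq_exp_subst_sq`): `q(0) = 1`, `(Dq/q)(0) = 0`, `D(Dq/q)` constant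
  `⟹ q = exp(ε log_W²)²`. For the → direction: `q := Σ/σ²` (`σ` from §1) has `q([2]z) = q⁴` from the two
  duplication identities (`σ²` satisfies it by the sibling file), whence `L := Dq/q` has `L∘[2] = 2L`,
  `DL∘[2] = DL`, `DL` constant; so `Σ = (σe^{ε log²})²` is the square of a normalised odd solution: even,
  and a solution of the squared equation (`IsFormallyOdd.sq`, `SatisfiesSigmaODE.sq`).
* §5 the ← direction: `zDΣ = G_Σ·Σ` (`G = sigmaSqG`, the receptacle's pole clearing), so the difference of
  the squared equations for `Σ` and `σ²` reads `2ω(c - c₀)z² = -z²L'`, `DL = -2(c - c₀)` constant, and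
  `[z¹]q = [z³]Σ - 2[z²]σ = a₁ - a₁ = 0` (`IsMazurTateSigmaSqPair.coeff_three_eq`,
  `two_mul_coeff_two_of_isFormallyOdd`); rigidity again gives `Σ = (σe^{ε log²})²`
  (`IsMazurTateSigmaSqPair.exists_sq_eq`: **a sigma-squared pair is the square of a normalised odd formal
  solution with the same constant**), and `sigmaSqDivisionIdentity_sq_of_satisfiesSigmaODE` (sibling file)
  gives the identities. `SatisfiesSigmaSqODE.const_eq`: `Σ` determines `c`.
  `IsMazurTateSigmaSqPair.thetaSq_formal`: the SQUARED theta relation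
  `Σ(u+v)Σ(u-v)u⁴v⁴ = (u²X(v) - v²X(u))²Σ(u)²Σ(v)²` in `ℚ_p⟦u,v⟧` (square of Blakestad–Grant Prop. 14 for
  `σ₁`) — the integral identity behind a parallelogram law for the sigma-squared height.
* §6 `p = 2`: combine with `exists_isSigmaSqDivisionSeries_two` / `IsSigmaSqDivisionSeries.unique_two`.

## Sources

* [MazurTate1991] B. Mazur, J. Tate, *The `p`-adic sigma function*, Duke Math. J. 62 (1991), §§2–3,
  Thm. 3.1 (equivalent characterisations of `σ`; cite-only on the hub, acq-00916 — this file PROVES the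
  equivalence of the two characterisations the tree has typed).
* [Silverman2005DivPoly] J. H. Silverman, Math. Ann. 332 (2005) = arXiv math/0404412, §5 Thm. 11 and
  Remark 2 (held, `paper:arxiv-math-0404412` p0011).
* [MazurSteinTate2006] B. Mazur, W. Stein, J. Tate, Doc. Math. Extra Vol. Coates (2006), Thm. 1.3, §3.1
  (the differential equation and its formal solutions).
* [BlakestadGrant2023] C. Blakestad, D. Grant, J. Number Theory 249 (2023), §2.2, Thm. 1, Thm. 2
  (`σ = z·exp g`, zeta series), Prop. 14.
* [SilvermanAEC2009] J. H. Silverman, *AEC* 2nd ed., IV.2.3, IV.4.3, IV.5.5.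

## Design notes

Proofs only; no `def`, no named fact, no instance, no notation. The `p = 2` statements take the printed
fact as a hypothesis `(h : mazurTate_sigmaSq_existsUnique_two)` (D-0014). Helper lemmas are `private`.
-/

noncomputable section

open scoped Classical
open PowerSeries Literature.NumberTheory.EllipticCurves Literature.RingTheory.FormalGroups

namespace WeierstrassCurve

/-! ### §1. A normalised odd solution of the sigma equation exists on every Weierstrass curve over `ℚ_p` -/

section Existence

variable {p : ℕ} [Fact p.Prime] (V : WeierstrassCurve ℚ_[p])

/-- The differential `x·ω` is formally exact over a field of characteristic `0`: every
`[z^{k+1}](X·W)` is divisible by `k` (for `k = 0`: `[z¹](X·W) = -a₁ + a₁ = 0`). [folklore] -/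
private theorem natCast_dvd_coeff_succ (W : WeierstrassCurve ℚ_[p]) (k : ℕ) :
    (k : ℚ_[p]) ∣ coeff (k + 1) ((W.formalXMulSq - C (0 : ℚ_[p]) * X ^ 2) * W.formalInvDiff) := by
  rcases k with _ | k
  · rw [Nat.cast_zero, zero_dvd_iff, zero_add, map_zero, zero_mul, sub_zero, coeff_one_mul_eq,
      coeff_zero_eq_constantCoeff_apply, constantCoeff_formalXMulSq, coeff_one_formalInvDiff,
      coeff_one_formalXMulSq, coeff_zero_eq_constantCoeff_apply, constantCoeff_formalInvDiff]
    ring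
  · exact (isUnit_iff_ne_zero.mpr (Nat.cast_ne_zero.mpr k.succ_ne_zero)).dvd

/-- **On every Weierstrass curve `V/ℚ_p` the sigma equation `x + c = -D(Dσ/σ)` has, for some
constant `c`, a normalised ODD formal solution `σ = z + ⋯ ∈ ℚ_p⟦z⟧`** (no integrality claimed):
on the model `V' = vc • V` with `a₁ = a₃ = 0` (`vc = toCharNeTwoNF`) take Blakestad–Grant's
`σ' = z·exp ∫(Λω - 1)/z` for an EVEN zeta series `Λ` with `zΛ' - Λ = -Xω` (`β = 0`, which is formally
exact over a field), odd by parity, and transport it back along the change of variables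
(`σ = u⁻¹σ' ∘ θ`, `c = u²c' - r`). [Blakestad–Grant 2023, §2.2 and Thm. 1 (the construction
`σ = tσ̃`, `σ̃ = exp g`); Mazur–Tate 1991, §3; Mazur–Stein–Tate 2006, §3.1 (the formal solutions of
the sigma equation)] [cite: BlakestadGrant2023, Thm. 1] -/
theorem exists_isFormallyOdd_satisfiesSigmaODE :
    ∃ σ : ℚ_[p]⟦X⟧, ∃ c : ℚ_[p],
      constantCoeff σ = 0 ∧ coeff 1 σ = 1 ∧ V.IsFormallyOdd σ ∧ V.SatisfiesSigmaODE σ c := by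
  haveI : Invertible (2 : ℚ_[p]) := invertibleOfNonzero two_ne_zero
  haveI := IsAddTorsionFree.of_module_rat (M := ℚ_[p])
  set V' := V.toCharNeTwoNF • V with hV'
  haveI : V'.IsCharNeTwoNF := V.toCharNeTwoNF_spec
  -- an even zeta series of `V'` with `β = 0`
  obtain ⟨Λ₀, h00, hΛ₀, -⟩ := V'.exists_padicWeierstrassZetaSeries (natCast_dvd_coeff_succ V')
  obtain ⟨hΛ, hc⟩ := zetaSeries_sub_C_mul_X hΛ₀ (coeff 1 Λ₀)
  set Λ := Λ₀ - C (coeff 1 Λ₀) * X with hΛdef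
  have h0 : constantCoeff Λ = 1 := hc.trans h00
  have h1 : coeff 1 Λ = 0 := by
    rw [hΛdef, map_sub, coeff_C_mul, coeff_one_X, mul_one, sub_self]
  have hΦ : rescale (-1 : ℚ_[p]) ((V'.formalXMulSq - C (0 : ℚ_[p]) * X ^ 2) * V'.formalInvDiff) =
      (V'.formalXMulSq - C (0 : ℚ_[p]) * X ^ 2) * V'.formalInvDiff := by
    rw [map_zero, zero_mul, sub_zero, map_mul, V'.rescale_neg_one_formalXMulSq,
      V'.rescale_neg_one_formalInvDiff]
  have hev : rescale (-1 : ℚ_[p]) Λ = Λ := rescale_neg_one_eq_self_of_zetaSeries hΛ hΦ h1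
  have hΛω : X * d⁄dX ℚ_[p] Λ - Λ = -((V'.formalXMulSq - C (0 : ℚ_[p]) * X ^ 2) * V'.formalOmega) := by
    rw [← formalInvDiff_eq_formalOmega]; exact hΛ
  -- Blakestad–Grant's `σ' = z·exp(g)` on `V'`
  have hσ'0 : constantCoeff (V'.sigmaOfZeta Λ) = 0 := V'.constantCoeff_sigmaOfZeta Λ
  have hσ'1 : coeff 1 (V'.sigmaOfZeta Λ) = 1 := V'.coeff_one_sigmaOfZeta Λ
  have hodd' : V'.IsFormallyOdd (V'.sigmaOfZeta Λ) := V'.isFormallyOdd_sigmaOfZeta hev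
  have hODE' : V'.SatisfiesSigmaODE (V'.sigmaOfZeta Λ) (-0) := V'.satisfiesSigmaODE_sigmaOfZeta h0 hΛω
  -- transport along `vc`
  rw [hV'] at hodd' hODE' hσ'0 hσ'1
  refine ⟨C ((V.toCharNeTwoNF.u⁻¹ : ℚ_[p]ˣ) : ℚ_[p]) *
      ((V.toCharNeTwoNF • V).sigmaOfZeta Λ).subst (V.formalVariableChange V.toCharNeTwoNF),
    (V.toCharNeTwoNF.u : ℚ_[p]) ^ 2 * (-0) - V.toCharNeTwoNF.r, ?_, ?_,
    hodd'.variableChange_subst _, hODE'.variableChange_subst hσ'0 hσ'1⟩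
  · rw [map_mul, V.constantCoeff_subst_formalVariableChange V.toCharNeTwoNF hσ'0, mul_zero]
  · rw [coeff_C_mul, V.coeff_one_subst_formalVariableChange V.toCharNeTwoNF hσ'1, Units.inv_mul]

end Existence

/-! ### §2. Calculus of the invariant derivation `D = d/ω`: chain rule along `[n]`, `D`-constants,
`[2]`-invariants, the Wronskian lemma, and `D exp(ε·log_W²) = 2ε·log_W·exp(ε·log_W²)` -/

section Calculus

variable {p : ℕ} [Fact p.Prime] (V : WeierstrassCurve ℚ_[p])

/-- **Chain rule along the formal multiplication**: `D(f ∘ [n]) = n·(Df) ∘ [n]` — `[n]` multiplies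
the invariant differential by `n` (`ω([n])·[n]' = n·ω`, Silverman AEC IV.4.3).
[Silverman AEC IV.4.3, IV.2.3] [cite: SilvermanAEC2009, IV.4.3] -/
theorem formalInvariantDerivation_subst_formalMul [V.IsIntegral ℤ_[p]] (f : ℚ_[p]⟦X⟧) (n : ℕ) :
    V.formalInvariantDerivation (f.subst (V.formalMul n)) =
      (n : ℚ_[p]⟦X⟧) * (V.formalInvariantDerivation f).subst (V.formalMul n) := by
  have hs := V.hasSubst_formalMul n
  have hω := V.formalOmega_subst_formalMul_mul_derivative n
  have hηω : V.formalEta * V.formalOmega = 1 := V.formalEta_mul_formalOmega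
  have hηωn : V.formalEta.subst (V.formalMul n) * V.formalOmega.subst (V.formalMul n) = 1 := by
    rw [← subst_mul hs, hηω, ← coe_substAlgHom hs, map_one]
  rw [nsmul_eq_mul] at hω
  rw [formalInvariantDerivation_apply, formalInvariantDerivation_apply, derivative_subst ℚ_[p] hs,
    subst_mul hs]
  set F := (d⁄dX ℚ_[p] f).subst (V.formalMul n)
  set M := d⁄dX ℚ_[p] (V.formalMul n)
  set ηn := V.formalEta.subst (V.formalMul n)
  set ωn := V.formalOmega.subst (V.formalMul n)
  linear_combination (-(V.formalEta * F * M)) * hηωn + (V.formalEta * F * ηn) * hω +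
    ((n : ℚ_[p]⟦X⟧) * ηn * F) * hηω

/-- **`D`-constants are constants**: `Df = 0 ⇒ f = f(0)` (`D = η·d/dz`, `η` a unit, characteristic
`0`). [folklore] -/
private theorem eq_C_of_formalInvariantDerivation_eq_zero {f : ℚ_[p]⟦X⟧}
    (h : V.formalInvariantDerivation f = 0) : f = C (constantCoeff f) := by
  rw [formalInvariantDerivation_apply] at h
  have h' : d⁄dX ℚ_[p] f = 0 := (V.isUnit_formalEta.mul_right_eq_zero).mp h
  ext n
  rcases n with _ | n
  · simp
  · rw [coeff_C, if_neg (Nat.succ_ne_zero n)]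
    have e := congrArg (coeff n) h'
    rw [coeff_derivative, map_zero] at e
    exact (mul_eq_zero.mp e).resolve_right (by exact_mod_cast Nat.succ_ne_zero n)

/-- `[z^k]([2]^d) = 0` for `d > k` and `[z^k]([2]^k) = 2^k` (`[2](z) = 2z + ⋯`). [Silverman AEC IV.2.3]
[folklore] -/
private theorem coeff_formalMul_two_pow (k d : ℕ) :
    coeff k (V.formalMul 2 ^ d) = if d = k then (2 : ℚ_[p]) ^ k else if k < d then 0 else
      coeff k (V.formalMul 2 ^ d) := by
  have hX : V.formalMul 2 = X * sigmaShift (V.formalMul 2) := (X_mul_sigmaShift (V.constantCoeff_formalMul 2)).symm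
  have h2 : constantCoeff (sigmaShift (V.formalMul 2)) = 2 := by
    rw [constantCoeff_sigmaShift, V.coeff_one_formalMul' 2]; norm_num
  split_ifs with hdk hkd
  · subst hdk
    rw [hX, mul_pow, coeff_X_pow_mul', if_pos le_rfl, Nat.sub_self, coeff_zero_eq_constantCoeff, map_pow, h2]
  · rw [hX, mul_pow, coeff_X_pow_mul', if_neg (not_le.mpr hkd)]
  · rfl

/-- **Invariants of `[2]` are constants**: `h([2](z)) = h(z) ⇒ h = h(0)` (compare the lowest
non-constant coefficient: `[z^k]h([2]z) = 2^k[z^k]h + (lower coefficients)`). [folklore] -/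
private theorem eq_C_of_subst_formalMul_two_eq {h : ℚ_[p]⟦X⟧} (hh : h.subst (V.formalMul 2) = h) :
    h = C (constantCoeff h) := by
  have key : ∀ k j : ℕ, 1 ≤ j → j ≤ k → coeff j h = 0 := by
    intro k
    induction k with
    | zero => intro j hj hjk; omega
    | succ k ih =>
      intro j hj hjk
      rcases Nat.lt_or_ge j (k + 1) with hlt | hge
      · exact ih j hj (by omega)
      · obtain rfl : j = k + 1 := le_antisymm hjk hge
        have e := congrArg (coeff (k + 1)) hh
        rw [coeff_subst_eq_sum_range (V.constantCoeff_formalMul 2), Finset.sum_eq_single (k + 1)] at e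
        · rw [V.coeff_formalMul_two_pow, if_pos rfl] at e
          have hne : (2 : ℚ_[p]) ^ (k + 1) - 1 ≠ 0 := by
            have h2 : (2 ^ (k + 1) : ℕ) ≠ 1 := (Nat.one_lt_two_pow (Nat.succ_ne_zero k)).ne'
            refine sub_ne_zero.mpr ?_
            exact_mod_cast h2
          have e' : ((2 : ℚ_[p]) ^ (k + 1) - 1) * coeff (k + 1) h = 0 := by linear_combination e
          exact (mul_eq_zero.mp e').resolve_left hne
        · intro d hd hne
          have hdk : d < k + 1 := lt_of_le_of_ne (Nat.lt_succ_iff.mp (Finset.mem_range.mp hd)) hne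
          rcases Nat.eq_zero_or_pos d with rfl | hd1
          · rw [pow_zero, coeff_one, if_neg (Nat.succ_ne_zero k), zero_mul]
          · rw [ih d hd1 (by omega), mul_zero]
        · intro hmem
          exact absurd (Finset.mem_range.mpr (Nat.lt_succ_self _)) hmem
  ext n
  rcases n with _ | n
  · simp
  · rw [coeff_C, if_neg (Nat.succ_ne_zero n)]
    exact key (n + 1) (n + 1) (by omega) le_rfl

/-- **Wronskian lemma**: if `Df·g = f·Dg` and `g(0) = 1`, then `f = f(0)·g` (`D(f/g) = 0`).
[Blakestad–Grant 2023, proof of Prop. 14 ("the ratio … is a function `ν(t₂)`")] [folklore] -/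
private theorem eq_C_mul_of_formalInvariantDerivation_mul_eq {f g : ℚ_[p]⟦X⟧} (hg : constantCoeff g = 1)
    (h : V.formalInvariantDerivation f * g = f * V.formalInvariantDerivation g) :
    f = C (constantCoeff f) * g := by
  have hgi : g * invOfUnit g 1 = 1 := mul_invOfUnit g 1 (by rw [hg, Units.val_one])
  set ig := invOfUnit g 1 with hig
  have hd : g * V.formalInvariantDerivation ig + ig * V.formalInvariantDerivation g = 0 := by
    have e := congrArg V.formalInvariantDerivation hgi
    rwa [Derivation.leibniz, smul_eq_mul, smul_eq_mul, Derivation.map_one_eq_zero] at e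
  have hDr : V.formalInvariantDerivation (f * ig) = 0 := by
    have hg0 : g ≠ 0 := fun h0 => by rw [h0, map_zero] at hg; exact zero_ne_one hg
    refine (mul_eq_zero.mp ?_).resolve_left hg0
    rw [Derivation.leibniz, smul_eq_mul, smul_eq_mul]
    linear_combination f * hd + ig * h
  have hr := V.eq_C_of_formalInvariantDerivation_eq_zero hDr
  have hig0 : constantCoeff ig = 1 := by rw [hig, constantCoeff_invOfUnit, inv_one, Units.val_one]
  rw [map_mul, hig0, mul_one] at hr
  calc f = f * (g * ig) := by rw [hgi, mul_one]
    _ = (f * ig) * g := by ring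
    _ = C (constantCoeff f) * g := by rw [← hr]

/-- `D log_W = 1` (`log_W = ∫ω`, `D = d/ω`). [Silverman AEC IV.4, IV.5] [folklore] -/
private theorem formalInvariantDerivation_formalLog : V.formalInvariantDerivation V.formalLog = 1 := by
  rw [formalInvariantDerivation_apply, derivative_formalLog, V.formalEta_mul_formalOmega]

/-- `ε·log_W²` has no constant term. [folklore] -/
private theorem constantCoeff_C_mul_formalLog_sq (ε : ℚ_[p]) :
    constantCoeff (C ε * V.formalLog ^ 2) = 0 := by
  rw [map_mul, map_pow, constantCoeff_formalLog, zero_pow two_ne_zero, mul_zero]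

/-- **`D exp(ε·log_W²) = 2ε·log_W·exp(ε·log_W²)`.** [folklore] -/
private theorem formalInvariantDerivation_exp_subst (ε : ℚ_[p]) :
    V.formalInvariantDerivation ((exp ℚ_[p]).subst (C ε * V.formalLog ^ 2)) =
      2 * C ε * V.formalLog * (exp ℚ_[p]).subst (C ε * V.formalLog ^ 2) := by
  have hg0 := V.constantCoeff_C_mul_formalLog_sq ε
  have hηω : V.formalEta * V.formalOmega = 1 := V.formalEta_mul_formalOmega
  rw [formalInvariantDerivation_apply, derivative_exp_subst hg0, Derivation.leibniz, Derivation.leibniz_pow,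
    derivative_C, derivative_formalLog, smul_zero, add_zero, smul_eq_mul, nsmul_eq_mul, Nat.cast_ofNat,
    Nat.add_one_sub_one, pow_one]
  linear_combination (2 * C ε * V.formalLog * (exp ℚ_[p]).subst (C ε * V.formalLog ^ 2)) * hηω

/-- `exp(ε·log_W²)` is EVEN: invariant under `z ↦ i(z)` (`log_W ∘ i = -log_W`). [folklore] -/
private theorem exp_subst_subst_formalNeg (ε : ℚ_[p]) :
    PowerSeries.subst V.formalNeg ((exp ℚ_[p]).subst (C ε * V.formalLog ^ 2)) =
      (exp ℚ_[p]).subst (C ε * V.formalLog ^ 2) := by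
  have hg0 := V.constantCoeff_C_mul_formalLog_sq ε
  have hi := V.hasSubst_formalNeg
  rw [PowerSeries.subst_comp_subst_apply (PowerSeries.HasSubst.of_constantCoeff_zero' hg0) hi,
    subst_mul hi, subst_C, subst_pow hi, formalLog_subst_formalNeg, neg_sq]
  rfl

end Calculus

/-! ### §3. Twisting a solution of the sigma equation by `exp(ε·log_W²)` shifts the constant by `-2ε` -/

section Twist

variable {p : ℕ} [Fact p.Prime] (V : WeierstrassCurve ℚ_[p])

variable {V} in
/-- **`(σ·exp(ε log_W²), c - 2ε)` is again a normalised odd solution of the sigma equation** when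
`(σ, c)` is: `D log(σ e^{ε log²}) = D log σ + 2ε log`, so `-D(D log(σe^{ε log²})) = x + c - 2ε`; parity is
kept since `log ∘ i = -log`. This is the one-parameter family of formal solutions of Mazur–Tate's
equation (the constant of integration that integrality pins down).
[Mazur–Tate 1991, §3 (proof of Thm. 3.1); Mazur–Stein–Tate 2006, §3.1] [cite: MazurSteinTate2006, Thm. 1.3] -/
theorem SatisfiesSigmaODE.mul_exp_subst {σ : ℚ_[p]⟦X⟧} {c : ℚ_[p]} (hσ0 : constantCoeff σ = 0)
    (hσ1 : coeff 1 σ = 1) (h : V.SatisfiesSigmaODE σ c) (ε : ℚ_[p]) :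
    constantCoeff (σ * (exp ℚ_[p]).subst (C ε * V.formalLog ^ 2)) = 0 ∧
      coeff 1 (σ * (exp ℚ_[p]).subst (C ε * V.formalLog ^ 2)) = 1 ∧
      V.SatisfiesSigmaODE (σ * (exp ℚ_[p]).subst (C ε * V.formalLog ^ 2)) (c - 2 * ε) := by
  set E := (exp ℚ_[p]).subst (C ε * V.formalLog ^ 2) with hE
  have hg0 := V.constantCoeff_C_mul_formalLog_sq ε
  have hE0 : constantCoeff E = 1 := constantCoeff_exp_subst hg0
  have h0 : constantCoeff (σ * E) = 0 := by rw [map_mul, hσ0, zero_mul]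
  have h1 : coeff 1 (σ * E) = 1 := by
    rw [coeff_one_mul_eq, coeff_zero_eq_constantCoeff_apply, hσ0, zero_mul, zero_add, hσ1,
      coeff_zero_eq_constantCoeff_apply, hE0, mul_one]
  refine ⟨h0, h1, ?_⟩
  have hN := (satisfiesSigmaODE_iff_X_sq_mul_logDeriv₂Num hσ0 hσ1).mp h
  rw [satisfiesSigmaODE_iff_X_sq_mul_logDeriv₂Num h0 h1, logDeriv₂Num_mul, logDeriv₂Num_def _ E]
  have hDE : V.formalInvariantDerivation E = 2 * C ε * V.formalLog * E := V.formalInvariantDerivation_exp_subst ε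
  have hDlog := V.formalInvariantDerivation_formalLog
  have hD2 : V.formalInvariantDerivation (2 : ℚ_[p]⟦X⟧) = 0 := by
    rw [show (2 : ℚ_[p]⟦X⟧) = ((2 : ℕ) : ℚ_[p]⟦X⟧) by norm_cast]; exact Derivation.map_natCast _ 2
  have hDDE : V.formalInvariantDerivation (V.formalInvariantDerivation E) =
      2 * C ε * E + (2 * C ε * V.formalLog) ^ 2 * E := by
    rw [hDE]
    simp only [Derivation.leibniz, smul_eq_mul, formalInvariantDerivation_C, hD2, hDlog, hDE]
    ring
  rw [hDDE, hDE, map_sub, map_mul, map_ofNat]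
  linear_combination E ^ 2 * hN

variable {V} in
/-- Parity of the twist: `σ` odd ⇒ `σ·exp(ε log_W²)` odd (`log_W ∘ i = -log_W`).
[Mazur–Stein–Tate 2006, Thm. 1.3 («odd function»); Harvey 2008, §4] [cite: MazurSteinTate2006, Thm. 1.3] -/
theorem IsFormallyOdd.mul_exp_subst {σ : ℚ_[p]⟦X⟧} (h : V.IsFormallyOdd σ) (ε : ℚ_[p]) :
    V.IsFormallyOdd (σ * (exp ℚ_[p]).subst (C ε * V.formalLog ^ 2)) := by
  unfold IsFormallyOdd at h ⊢
  rw [subst_mul V.hasSubst_formalNeg, h, V.exp_subst_subst_formalNeg ε, neg_mul]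

end Twist

/-! ### §4. Rigidity: `q(0) = 1`, `z·D log q = 0 + ⋯`, `D(D log q)` constant ⟹ `q = exp(ε log_W²)²`;
the bridge «division polynomials ⟹ differential equation» -/

section Bridge

variable {p : ℕ} [Fact p.Prime] (V : WeierstrassCurve ℚ_[p])

/-- **Factoring a normalised `Σ = z² + ⋯` over a reference `σ = z + ⋯`**: `Σ = q·σ²` with
`q(0) = 1` and `[z¹]q = [z³]Σ - 2[z²]σ` (`q = (Σ/z²)·(σ/z)⁻²`). [folklore] -/
private theorem exists_eq_mul_sq {Sq σ : ℚ_[p]⟦X⟧} (hS0 : constantCoeff Sq = 0) (hS1 : coeff 1 Sq = 0)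
    (hS2 : coeff 2 Sq = 1) (hσ0 : constantCoeff σ = 0) (hσ1 : coeff 1 σ = 1) :
    ∃ q : ℚ_[p]⟦X⟧, constantCoeff q = 1 ∧ Sq = q * σ ^ 2 ∧ coeff 1 q = coeff 3 Sq - 2 * coeff 2 σ := by
  set s := sigmaShift σ with hs
  have hσ : X * s = σ := X_mul_sigmaShift hσ0
  have hs0 : constantCoeff s = 1 := by rw [hs, constantCoeff_sigmaShift, hσ1]
  have hs1 : coeff 1 s = coeff 2 σ := by rw [hs, coeff_sigmaShift]
  set S₁ := sigmaShift Sq with hS₁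
  have hSX : X * S₁ = Sq := X_mul_sigmaShift hS0
  have hS₁0 : constantCoeff S₁ = 0 := by rw [hS₁, constantCoeff_sigmaShift, hS1]
  set S := sigmaShift S₁ with hS
  have hSX' : X * S = S₁ := X_mul_sigmaShift hS₁0
  have hS0' : constantCoeff S = 1 := by rw [hS, constantCoeff_sigmaShift, hS₁, coeff_sigmaShift, hS2]
  have hS1' : coeff 1 S = coeff 3 Sq := by rw [hS, coeff_sigmaShift, hS₁, coeff_sigmaShift]
  have hs20 : constantCoeff (s ^ 2) = 1 := by rw [map_pow, hs0, one_pow]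
  have hs2i : s ^ 2 * invOfUnit (s ^ 2) 1 = 1 := mul_invOfUnit _ _ (by rw [hs20, Units.val_one])
  have hi0 : constantCoeff (invOfUnit (s ^ 2) 1) = 1 := by
    rw [constantCoeff_invOfUnit, inv_one, Units.val_one]
  -- `[z¹]((s²)⁻¹) = -[z¹](s²) = -2[z²]σ`
  have hs21 : coeff 1 (s ^ 2) = 2 * coeff 2 σ := by
    rw [sq, coeff_one_mul_eq, coeff_zero_eq_constantCoeff_apply, hs0, hs1]; ring
  have hi1 : coeff 1 (invOfUnit (s ^ 2) 1) = -(2 * coeff 2 σ) := by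
    have e := congrArg (coeff 1) hs2i
    rw [coeff_one_mul_eq, coeff_zero_eq_constantCoeff_apply, hs20, one_mul, coeff_zero_eq_constantCoeff_apply,
      hi0, mul_one, coeff_one, if_neg one_ne_zero, hs21] at e
    linear_combination e
  refine ⟨S * invOfUnit (s ^ 2) 1, ?_, ?_, ?_⟩
  · rw [map_mul, hS0', hi0, mul_one]
  · calc Sq = X ^ 2 * S := by rw [← hSX, ← hSX']; ring
      _ = X ^ 2 * S * (s ^ 2 * invOfUnit (s ^ 2) 1) := by rw [hs2i, mul_one]
      _ = S * invOfUnit (s ^ 2) 1 * (X * s) ^ 2 := by ring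
      _ = S * invOfUnit (s ^ 2) 1 * σ ^ 2 := by rw [hσ]
  · rw [coeff_one_mul_eq, coeff_zero_eq_constantCoeff_apply, hS0', hi1, hS1', coeff_zero_eq_constantCoeff_apply,
      hi0]
    ring

variable {V} in
/-- **Rigidity of the logarithmic derivative.** If `q(0) = 1`, `L := Dq/q` has `L(0) = 0` and `DL`
is a constant `ℓ`, then `L = ℓ·log_W` and `q = exp((ℓ/4)·log_W²)²` — the Wronskian of `q` and
`exp((ℓ/4)log_W²)²` vanishes. (`D = d/ω`, `D log_W = 1`.) [Mazur–Tate 1991, §3 (proof of Thm. 3.1: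
the constants of integration); Mazur–Stein–Tate 2006, §3.1] [folklore] -/
private theorem exists_eq_exp_subst_sq {q : ℚ_[p]⟦X⟧} (hq0 : constantCoeff q = 1)
    (hL0 : constantCoeff (V.formalInvariantDerivation q * invOfUnit q 1) = 0)
    (hDL : ∃ ℓ : ℚ_[p], V.formalInvariantDerivation (V.formalInvariantDerivation q * invOfUnit q 1) = C ℓ) :
    ∃ ε : ℚ_[p], q = ((exp ℚ_[p]).subst (C ε * V.formalLog ^ 2)) ^ 2 := by
  obtain ⟨ℓ, hDL⟩ := hDL
  set D := V.formalInvariantDerivation with hD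
  have hqi : q * invOfUnit q 1 = 1 := mul_invOfUnit q 1 (by rw [hq0, Units.val_one])
  set iq := invOfUnit q 1 with hiq
  set L := D q * iq with hL
  have hDq : D q = L * q := by
    rw [hL]
    calc D q = D q * (q * iq) := by rw [hqi, mul_one]
      _ = D q * iq * q := by ring
  -- `L = ℓ·log_W`
  have hDlog : D V.formalLog = 1 := V.formalInvariantDerivation_formalLog
  have hDiff : D (L - C ℓ * V.formalLog) = 0 := by
    rw [map_sub, hDL, Derivation.leibniz, hDlog, smul_eq_mul, smul_eq_mul, mul_one, hD,
      formalInvariantDerivation_C, mul_zero, add_zero, sub_self]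
  have hLlog : L = C ℓ * V.formalLog := by
    have e := V.eq_C_of_formalInvariantDerivation_eq_zero hDiff
    rw [map_sub, hL0, map_mul, constantCoeff_C, constantCoeff_formalLog, mul_zero, sub_zero, map_zero] at e
    exact sub_eq_zero.mp e
  -- `F = E²`, `E = exp((ℓ/4) log²)`: `DF = L·F`
  set E := (exp ℚ_[p]).subst (C (ℓ / 4) * V.formalLog ^ 2) with hE
  have hDE : D E = 2 * C (ℓ / 4) * V.formalLog * E := V.formalInvariantDerivation_exp_subst (ℓ / 4)
  have hC4 : (4 : ℚ_[p]⟦X⟧) * C (ℓ / 4) = C ℓ := by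
    rw [← map_ofNat C 4, ← map_mul]; congr 1; ring
  have hDF : D (E ^ 2) = L * E ^ 2 := by
    rw [Derivation.leibniz_pow, hDE, hLlog, smul_eq_mul, nsmul_eq_mul, Nat.cast_ofNat, Nat.add_one_sub_one,
      pow_one]
    linear_combination (V.formalLog * E ^ 2) * hC4
  have hW : D q * E ^ 2 = q * D (E ^ 2) := by rw [hDq, hDF]; ring
  have hE20 : constantCoeff (E ^ 2) = 1 := by
    rw [map_pow, hE, constantCoeff_exp_subst (V.constantCoeff_C_mul_formalLog_sq (ℓ / 4)), one_pow]
  have h := V.eq_C_mul_of_formalInvariantDerivation_mul_eq hE20 hW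
  rw [hq0, map_one, one_mul] at h
  exact ⟨ℓ / 4, h⟩

variable {V} in
/-- **`q(z) := Σ(z)/σ(z)²` satisfies `q([2]z) = q(z)⁴` when `Σ` and `σ²` both satisfy the squared
duplication identity** `z⁶·S([2]z) = S(z)⁴·P₂(z)` (cancel the non-zero `σ²`-identity in the domain
`ℚ_p⟦z⟧`). [Silverman 2005, §5 Rem. 2 (`n = 2`)] [folklore] -/
private theorem subst_formalMul_two_eq_pow_four {Sq σ q : ℚ_[p]⟦X⟧} (hσne : σ ≠ 0) (hSq : Sq = q * σ ^ 2)
    (hid : V.SigmaSqDivisionIdentity Sq 2) (hidσ : V.SigmaSqDivisionIdentity (σ ^ 2) 2) :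
    q.subst (V.formalMul 2) = q ^ 4 := by
  have hs2 := V.hasSubst_formalMul 2
  rw [SigmaSqDivisionIdentity] at hid hidσ
  norm_num at hid hidσ
  have hne : (X : ℚ_[p]⟦X⟧) ^ 6 * (σ ^ 2).subst (V.formalMul 2) ≠ 0 := by
    rw [hidσ]
    exact mul_ne_zero (pow_ne_zero _ (pow_ne_zero _ hσne)) (V.sigmaSqDivisionRHS_ne_zero (by norm_num))
  rw [hSq, subst_mul hs2, mul_pow] at hid
  have h : (q.subst (V.formalMul 2) - q ^ 4) * ((X : ℚ_[p]⟦X⟧) ^ 6 * (σ ^ 2).subst (V.formalMul 2)) = 0 := by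
    linear_combination hid - q ^ 4 * hidσ
  exact sub_eq_zero.mp ((mul_eq_zero.mp h).resolve_right hne)

variable {V} in
/-- **Division polynomials ⟹ differential equation (Mazur–Tate 1991, Thm. 3.1, for the squared sigma
function).** Let `V/ℚ_p` be `p`-integral and elliptic (any prime `p`). If `Σ = z² + ⋯ ∈ z²ℤ_p⟦z⟧`
satisfies the squared DUPLICATION identity `z⁶Σ([2]z) = Σ(z)⁴·z⁶ψ₂²(x(z))` («`σ²(2Q) = σ(Q)⁸F₂²(Q)`»),
then `Σ` is even and satisfies the squared Mazur–Stein–Tate equation `2(x + c) = -D(DΣ/Σ)` for some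
`c ∈ ℚ_p`: `(Σ, c)` is a sigma-squared pair (`IsMazurTateSigmaSqPair`). Proof: for a normalised odd
formal solution `σ` of the sigma equation (§1), `q = Σ/σ²` satisfies `q([2]z) = q⁴` (§A of the sibling
file gives the identity for `σ²`), hence `D log q ∘ [2] = 2·D log q`, `D²log q ∘ [2] = D² log q`,
so `D² log q` is constant and `q = exp(ε log_W²)²` (§4); then `Σ = (σ·e^{ε log²})²` is the square of a
normalised odd solution with constant `c - 2ε` (§3). [Mazur–Tate 1991, Thm. 3.1; Silverman 2005, §5
Thm. 11 and Rem. 2; Mazur–Stein–Tate 2006, Thm. 1.3] [cite: MazurTate1991, Thm. 3.1]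
[cite: Silverman2005DivPoly, §5 Rem. 2] -/
theorem exists_isMazurTateSigmaSqPair_of_sigmaSqDivisionIdentity_two [hV : V.IsIntegral ℤ_[p]]
    [V.IsElliptic] {Sq : ℚ_[p]⟦X⟧} (hS0 : constantCoeff Sq = 0) (hS1 : coeff 1 Sq = 0)
    (hS2 : coeff 2 Sq = 1) (hint : ∀ n, ‖coeff n Sq‖ ≤ 1) (hid : V.SigmaSqDivisionIdentity Sq 2) :
    ∃ c : ℚ_[p], V.IsMazurTateSigmaSqPair Sq c := by
  obtain ⟨σ, c₀, hσ0, hσ1, hodd, hODE⟩ := V.exists_isFormallyOdd_satisfiesSigmaODE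
  have hσne : σ ≠ 0 := fun h => by
    have := congrArg (coeff 1) h; rw [hσ1, map_zero] at this; exact one_ne_zero this
  obtain ⟨q, hq0, hSq, -⟩ := exists_eq_mul_sq hS0 hS1 hS2 hσ0 hσ1
  have hq := subst_formalMul_two_eq_pow_four hσne hSq hid (sigmaSqDivisionIdentity_sq_two hσ0 hσ1 hodd hODE)
  -- the logarithmic derivative `L = Dq/q`: `L ∘ [2] = 2L`, `DL ∘ [2] = DL`
  set D := V.formalInvariantDerivation with hD
  have hs2 := V.hasSubst_formalMul 2
  have hqi : q * invOfUnit q 1 = 1 := mul_invOfUnit q 1 (by rw [hq0, Units.val_one])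
  set iq := invOfUnit q 1 with hiq
  set L := D q * iq with hL
  have hDq : D q = L * q := by
    rw [hL]
    calc D q = D q * (q * iq) := by rw [hqi, mul_one]
      _ = D q * iq * q := by ring
  have hqne : q ≠ 0 := fun h => by rw [h, map_zero] at hq0; exact zero_ne_one hq0
  have h2ne : (2 : ℚ_[p]⟦X⟧) ≠ 0 := fun h => by
    have e := congrArg constantCoeff h; rw [map_ofNat, map_zero] at e; exact two_ne_zero e
  have hL2 : L.subst (V.formalMul 2) = 2 * L := by
    have e := congrArg D hq
    rw [hD, V.formalInvariantDerivation_subst_formalMul q 2, ← hD, Derivation.leibniz_pow, hDq, subst_mul hs2,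
      hq, smul_eq_mul, nsmul_eq_mul, Nat.cast_ofNat, Nat.cast_ofNat] at e
    have e' : (2 * q ^ 4) * (L.subst (V.formalMul 2) - 2 * L) = 0 := by linear_combination e
    exact sub_eq_zero.mp ((mul_eq_zero.mp e').resolve_left (mul_ne_zero h2ne (pow_ne_zero 4 hqne)))
  have hL0 : constantCoeff L = 0 := by
    have e := congrArg constantCoeff hL2
    rw [Literature.NumberTheory.EllipticCurves.constantCoeff_subst_of_constantCoeff_eq_zero
      (V.constantCoeff_formalMul 2)] at e
    have e' : constantCoeff (2 * L) = 2 * constantCoeff L := by rw [map_mul, map_ofNat]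
    rw [e'] at e
    linear_combination -e
  have hD2 : D (2 : ℚ_[p]⟦X⟧) = 0 := by
    rw [show (2 : ℚ_[p]⟦X⟧) = ((2 : ℕ) : ℚ_[p]⟦X⟧) by norm_cast]; exact Derivation.map_natCast _ 2
  have hD2L : D (2 * L) = 2 * D L := by
    rw [Derivation.leibniz, smul_eq_mul, smul_eq_mul, hD2, mul_zero, add_zero]
  have hDL2 : (D L).subst (V.formalMul 2) = D L := by
    have e := congrArg D hL2
    rw [hD, V.formalInvariantDerivation_subst_formalMul L 2, ← hD, Nat.cast_ofNat, hD2L] at e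
    exact mul_left_cancel₀ h2ne e
  have hDL : ∃ ℓ : ℚ_[p], D L = C ℓ := ⟨_, V.eq_C_of_subst_formalMul_two_eq hDL2⟩
  obtain ⟨ε, hqE⟩ := exists_eq_exp_subst_sq hq0 hL0 hDL
  -- `Σ = (σ·E)²` with `σ·E` a normalised odd solution
  obtain ⟨h10, h11, hODE1⟩ := hODE.mul_exp_subst hσ0 hσ1 ε
  have hodd1 := hodd.mul_exp_subst ε
  have hSq1 : Sq = (σ * (exp ℚ_[p]).subst (C ε * V.formalLog ^ 2)) ^ 2 := by rw [hSq, hqE]; ring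
  refine ⟨c₀ - 2 * ε, ⟨hS0, hS1, hS2, hint, ?_, ?_⟩⟩
  · rw [hSq1]; exact hodd1.sq
  · rw [hSq1]; exact hODE1.sq h10 h11

variable {V} in
/-- **A sigma-squared division series is a sigma-squared pair**: Silverman's «`σ² ∈ z² + z³R⟦z⟧` with
`σ²(nQ) = σ(Q)^{2n²}F_n²(Q)` for all `n`» satisfies the squared Mazur–Stein–Tate differential equation
for some constant `c` (only `n = 2` is used). [Mazur–Tate 1991, Thm. 3.1; Silverman 2005, §5 Rem. 2]
[cite: MazurTate1991, Thm. 3.1] [cite: Silverman2005DivPoly, §5 Rem. 2] -/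
theorem IsSigmaSqDivisionSeries.exists_isMazurTateSigmaSqPair [hV : V.IsIntegral ℤ_[p]] [V.IsElliptic]
    {Sq : ℚ_[p]⟦X⟧} (h : V.IsSigmaSqDivisionSeries Sq) : ∃ c : ℚ_[p], V.IsMazurTateSigmaSqPair Sq c :=
  exists_isMazurTateSigmaSqPair_of_sigmaSqDivisionIdentity_two h.1 h.2.1 h.2.2.1 h.2.2.2.1
    (h.identity (by norm_num))

end Bridge

/-! ### §5. The converse: a sigma-squared pair satisfies every squared division identity -/

section Converse

variable {p : ℕ} [Fact p.Prime] (V : WeierstrassCurve ℚ_[p])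

/-- **`z·DΣ = G·Σ`** for `Σ = z² + ⋯` (`Σ(0) = [z¹]Σ = 0`, `[z²]Σ = 1`) and `G = sigmaSqG Σ =
(2S + zS')(ωS)⁻¹`, `Σ = z²S`: the receptacle's `G` is `z·D log Σ`. [Mazur–Stein–Tate 2006, Thm. 1.3
(`(1/σ)(dσ/ω)`); Silverman 2005, §5 Rem. 2] [folklore] -/
private theorem X_mul_formalInvariantDerivation_eq_sigmaSqG_mul {Sq : ℚ_[p]⟦X⟧} (hS0 : constantCoeff Sq = 0)
    (hS1 : coeff 1 Sq = 0) (hS2 : coeff 2 Sq = 1) :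
    X * V.formalInvariantDerivation Sq = V.sigmaSqG Sq * Sq := by
  set S₁ := sigmaShift Sq with hS₁
  have hSX : X * S₁ = Sq := X_mul_sigmaShift hS0
  have hS₁0 : constantCoeff S₁ = 0 := by rw [hS₁, constantCoeff_sigmaShift, hS1]
  set S := sigmaShift S₁ with hS
  have hSX' : X * S = S₁ := X_mul_sigmaShift hS₁0
  have hS0' : constantCoeff S = 1 := by rw [hS, constantCoeff_sigmaShift, hS₁, coeff_sigmaShift, hS2]
  have hSq : Sq = X ^ 2 * S := by rw [← hSX, ← hSX']; ring
  have hu : V.formalOmega * S * invOfUnit (V.formalOmega * S) 1 = 1 :=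
    mul_invOfUnit _ _ (by rw [map_mul, V.constantCoeff_formalOmega, hS0', one_mul, Units.val_one])
  have hηω : V.formalEta * V.formalOmega = 1 := V.formalEta_mul_formalOmega
  have hd : d⁄dX ℚ_[p] (X ^ 2 * S) = 2 * X * S + X ^ 2 * d⁄dX ℚ_[p] S := by
    rw [Derivation.leibniz, Derivation.leibniz_pow, derivative_X]
    simp only [smul_eq_mul, nsmul_eq_mul, Nat.cast_ofNat, Nat.add_one_sub_one, pow_one, mul_one]
    ring
  rw [sigmaSqG, ← hS, hSq, formalInvariantDerivation_apply, hd]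
  set I := invOfUnit (V.formalOmega * S) 1
  linear_combination (-(X ^ 2 * V.formalEta * (2 * S + X * d⁄dX ℚ_[p] S))) * hu +
    (X ^ 2 * (2 * S + X * d⁄dX ℚ_[p] S) * I * S) * hηω

variable {V} in
/-- **The constant is determined by `Σ`**: two sigma-squared equations for the same `Σ` have the same
`c` (`2ω(c₁ - c₂)z² = 0`). [Mazur–Stein–Tate 2006, Thm. 1.3] [cite: MazurSteinTate2006, Thm. 1.3] -/
theorem SatisfiesSigmaSqODE.const_eq {Sq : ℚ_[p]⟦X⟧} {c₁ c₂ : ℚ_[p]} (h₁ : V.SatisfiesSigmaSqODE Sq c₁)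
    (h₂ : V.SatisfiesSigmaSqODE Sq c₂) : c₁ = c₂ := by
  rw [SatisfiesSigmaSqODE] at h₁ h₂
  have e : 2 * (V.formalOmega * (C (c₁ - c₂) * X ^ 2)) = 0 := by
    rw [map_sub]; linear_combination h₁ - h₂
  have e2 := congrArg (coeff 2) e
  rw [show 2 * (V.formalOmega * (C (c₁ - c₂) * X ^ 2)) = C (2 * (c₁ - c₂)) * V.formalOmega * X ^ 2 by
      rw [map_mul, map_ofNat]; ring, coeff_mul_X_pow', if_pos le_rfl, Nat.sub_self, coeff_C_mul,
    coeff_zero_eq_constantCoeff, V.constantCoeff_formalOmega, mul_one, map_zero] at e2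
  have : (c₁ - c₂) = 0 := (mul_eq_zero.mp e2).resolve_left two_ne_zero
  exact sub_eq_zero.mp this


variable {V} in
/-- **A sigma-squared pair is the square of a normalised odd formal solution of the sigma equation
with the SAME constant**: `Σ = σ₁²`, `σ₁ = z + ⋯ ∈ ℚ_p⟦z⟧` odd, `x + c = -D(Dσ₁/σ₁)` (no integrality of
`σ₁`: at `p = 2` with `a₁` odd, `σ₁ ∉ ℤ₂⟦z⟧`). Proof: with a normalised odd formal solution `σ` of the
sigma equation (§1), `zDΣ = G_Σ·Σ` (`G = sigmaSqG`), so the difference of the squared equations for `Σ`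
and `σ²` reads `2ω(c - c₀)z² = -z²L'` with `L = D log q`, `q = Σ/σ²`; hence `DL = -2(c - c₀)` is constant,
`[z¹]q = [z³]Σ - 2[z²]σ = a₁ - a₁ = 0`, and rigidity (§4) gives `Σ = (σe^{ε log²})²`.
[Mazur–Tate 1991, §3 and Thm. 3.1; Mazur–Stein–Tate 2006, §3.1; Silverman 2005, §5 Rem. 2 («it is not
possible to unambiguously take a square root» in `R⟦z⟧`)] [cite: MazurTate1991, Thm. 3.1]
[cite: MazurSteinTate2006, Thm. 1.3] -/
theorem IsMazurTateSigmaSqPair.exists_sq_eq {Sq : ℚ_[p]⟦X⟧} {c : ℚ_[p]} (h : V.IsMazurTateSigmaSqPair Sq c) :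
    ∃ σ₁ : ℚ_[p]⟦X⟧, constantCoeff σ₁ = 0 ∧ coeff 1 σ₁ = 1 ∧ V.IsFormallyOdd σ₁ ∧
      V.SatisfiesSigmaODE σ₁ c ∧ Sq = σ₁ ^ 2 := by
  obtain ⟨σ, c₀, hσ0, hσ1, hodd, hODE⟩ := V.exists_isFormallyOdd_satisfiesSigmaODE
  obtain ⟨q, hq0, hSq, hq1⟩ := exists_eq_mul_sq h.constantCoeff_eq h.coeff_one_eq h.coeff_two_eq hσ0 hσ1
  -- normalisation of `σ²`
  have hT0 : constantCoeff (σ ^ 2) = 0 := by rw [map_pow, hσ0, zero_pow two_ne_zero]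
  have hT1 : coeff 1 (σ ^ 2) = 0 := by
    rw [pow_two, coeff_one_mul_eq, coeff_zero_eq_constantCoeff_apply, hσ0]; ring
  have hT2 : coeff 2 (σ ^ 2) = 1 := by
    rw [pow_two, coeff_two_mul_eq, coeff_zero_eq_constantCoeff_apply, hσ0, hσ1]; ring
  -- `[z¹]q = 0`: `[z³]Σ = a₁ = 2[z²]σ`
  have hq1' : coeff 1 q = 0 := by
    rw [hq1, h.coeff_three_eq, ← V.two_mul_coeff_two_of_isFormallyOdd hodd hσ0 hσ1, sub_self]
  -- the two squared equations and `zDΣ = GΣ`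
  have hODET : V.SatisfiesSigmaSqODE (σ ^ 2) c₀ := hODE.sq hσ0 hσ1
  have hG₁ := V.X_mul_formalInvariantDerivation_eq_sigmaSqG_mul h.constantCoeff_eq h.coeff_one_eq h.coeff_two_eq
  have hG₂ := V.X_mul_formalInvariantDerivation_eq_sigmaSqG_mul hT0 hT1 hT2
  set D := V.formalInvariantDerivation with hD
  set G₁ := V.sigmaSqG Sq with hG₁def
  set G₂ := V.sigmaSqG (σ ^ 2) with hG₂def
  have hqi : q * invOfUnit q 1 = 1 := mul_invOfUnit q 1 (by rw [hq0, Units.val_one])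
  set iq := invOfUnit q 1 with hiq
  set L := D q * iq with hL
  have hσne : σ ≠ 0 := fun h0 => by
    have := congrArg (coeff 1) h0; rw [hσ1, map_zero] at this; exact one_ne_zero this
  have hTne : σ ^ 2 ≠ 0 := pow_ne_zero 2 hσne
  -- `G₁ - G₂ = z·L`
  have hH : G₁ - G₂ = X * L := by
    have e : (G₁ - G₂ - X * L) * σ ^ 2 = 0 := by
      have h1 : X * D Sq = G₁ * Sq := hG₁
      rw [hSq, Derivation.leibniz, Derivation.leibniz_pow] at h1
      have h2 : X * D (σ ^ 2) = G₂ * σ ^ 2 := hG₂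
      rw [Derivation.leibniz_pow] at h2
      simp only [smul_eq_mul, nsmul_eq_mul, Nat.cast_ofNat, Nat.add_one_sub_one, pow_one] at h1 h2
      rw [hL]
      linear_combination (-iq) * h1 + (q * iq) * h2 - ((G₁ - G₂) * σ ^ 2) * hqi
    exact sub_eq_zero.mp ((mul_eq_zero.mp e).resolve_right hTne)
  -- the difference of the two equations: `2ω(c - c₀)z² = -z²L'`, so `DL = -2(c - c₀)`
  have hdiff : 2 * (V.formalOmega * (C (c - c₀) * X ^ 2)) = -(X ^ 2 * d⁄dX ℚ_[p] L) := by
    have e1 := h.ode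
    have e2 := hODET
    rw [SatisfiesSigmaSqODE] at e1 e2
    have e : 2 * (V.formalOmega * (C (c - c₀) * X ^ 2)) = (G₁ - G₂) - X * d⁄dX ℚ_[p] (G₁ - G₂) := by
      rw [map_sub, map_sub]; linear_combination e1 - e2
    rw [e, hH, Derivation.leibniz, derivative_X, smul_eq_mul, smul_eq_mul]
    ring
  have hDL : ∃ ℓ : ℚ_[p], D L = C ℓ := by
    refine ⟨-(2 * (c - c₀)), ?_⟩
    have hηω : V.formalEta * V.formalOmega = 1 := V.formalEta_mul_formalOmega
    have hDL' : D L = V.formalEta * d⁄dX ℚ_[p] L := V.formalInvariantDerivation_apply L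
    have hC : (C (-(2 * (c - c₀))) : ℚ_[p]⟦X⟧) = -(2 * C (c - c₀)) := by rw [map_neg, map_mul, map_ofNat]
    have e : X ^ 2 * (D L - C (-(2 * (c - c₀)))) = 0 := by
      rw [hDL', hC]
      linear_combination V.formalEta * hdiff - (2 * X ^ 2 * C (c - c₀)) * hηω
    exact sub_eq_zero.mp ((mul_eq_zero.mp e).resolve_left (pow_ne_zero 2 X_ne_zero))
  have hL0 : constantCoeff L = 0 := by
    rw [hL, map_mul, hD, formalInvariantDerivation_apply, map_mul, constantCoeff_formalEta, one_mul,
      constantCoeff_derivative, hq1', zero_mul]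
  obtain ⟨ε, hqE⟩ := exists_eq_exp_subst_sq hq0 hL0 hDL
  obtain ⟨h10, h11, hODE1⟩ := hODE.mul_exp_subst hσ0 hσ1 ε
  have hodd1 := hodd.mul_exp_subst ε
  have hSq1 : Sq = (σ * (exp ℚ_[p]).subst (C ε * V.formalLog ^ 2)) ^ 2 := by rw [hSq, hqE]; ring
  have hc : c = c₀ - 2 * ε := by
    have e := hODE1.sq h10 h11
    rw [← hSq1] at e
    exact h.ode.const_eq e
  exact ⟨_, h10, h11, hodd1, hc ▸ hODE1, hSq1⟩

variable {V} in
/-- **Differential equation ⟹ division polynomials for sigma-squared pairs (Mazur–Tate 1991,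
Thm. 3.1).** For `p`-integral elliptic `V/ℚ_p`, a sigma-squared pair `(Σ, c)` (`IsMazurTateSigmaSqPair`)
satisfies every squared `n`-division identity, `n ≥ 1` (`Σ = σ₁²` for a normalised odd solution `σ₁`,
`exists_sq_eq`, to which the sibling file applies). [Mazur–Tate 1991, Thm. 3.1; Silverman 2005, §5
Thm. 11 and Rem. 2] [cite: MazurTate1991, Thm. 3.1] [cite: Silverman2005DivPoly, §5 Rem. 2] -/
theorem IsMazurTateSigmaSqPair.sigmaSqDivisionIdentity [hV : V.IsIntegral ℤ_[p]] [V.IsElliptic]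
    {Sq : ℚ_[p]⟦X⟧} {c : ℚ_[p]} (h : V.IsMazurTateSigmaSqPair Sq c) {n : ℕ} (hn : 1 ≤ n) :
    V.SigmaSqDivisionIdentity Sq n := by
  obtain ⟨σ₁, h0, h1, hodd, hODE, hSq⟩ := h.exists_sq_eq
  rw [hSq]
  exact sigmaSqDivisionIdentity_sq_of_satisfiesSigmaODE h0 h1 hodd hODE hn

variable {V} in
/-- **A sigma-squared pair is a sigma-squared division series.** [Mazur–Tate 1991, Thm. 3.1; Silverman
2005, §5 Rem. 2] [cite: MazurTate1991, Thm. 3.1] [cite: Silverman2005DivPoly, §5 Rem. 2] -/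
theorem IsMazurTateSigmaSqPair.isSigmaSqDivisionSeries [hV : V.IsIntegral ℤ_[p]] [V.IsElliptic]
    {Sq : ℚ_[p]⟦X⟧} {c : ℚ_[p]} (h : V.IsMazurTateSigmaSqPair Sq c) : V.IsSigmaSqDivisionSeries Sq :=
  ⟨h.constantCoeff_eq, h.coeff_one_eq, h.coeff_two_eq, h.norm_coeff_le, fun _ hn => h.sigmaSqDivisionIdentity hn⟩

variable {V} in
/-- **The SQUARED theta relation for a sigma-squared pair, as a formal identity in `ℚ_p⟦u, v⟧`**:
`Σ(u +_F v)·Σ(u -_F v)·u⁴v⁴ = (u²X(v) - v²X(u))²·Σ(u)²·Σ(v)²`, i.e.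
`Σ(u+v)Σ(u-v)/(Σ(u)²Σ(v)²) = (x(v) - x(u))²` — the square of Blakestad–Grant's Prop. 14 for the odd root
`σ₁` of `Σ = σ₁²` (`thetaLHS_eq_thetaRHS`). All series displayed are `p`-integral when `Σ` is (the root
`σ₁` need not be): this is the identity to evaluate on `E₁(ℚ_p)` for the parallelogram law of the
sigma-squared height at `p = 2`. [Blakestad–Grant 2023, Prop. 14; Mazur–Tate 1991, Thm. 3.1]
[cite: BlakestadGrant2023, Prop. 14] [cite: MazurTate1991, Thm. 3.1] -/
theorem IsMazurTateSigmaSqPair.thetaSq_formal [hV : V.IsIntegral ℤ_[p]] [V.IsElliptic]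
    {Sq : ℚ_[p]⟦X⟧} {c : ℚ_[p]} (h : V.IsMazurTateSigmaSqPair Sq c) :
    Sq.subst V.formalGroupLaw * Sq.subst V.formalGroupLawSub *
        (MvPowerSeries.X 0 : MvPowerSeries (Fin 2) ℚ_[p]) ^ 4 * (MvPowerSeries.X 1) ^ 4 =
      ((MvPowerSeries.X 0) ^ 2 * V.formalXMulSq.subst (MvPowerSeries.X 1 : MvPowerSeries (Fin 2) ℚ_[p]) -
          (MvPowerSeries.X 1) ^ 2 * V.formalXMulSq.subst (MvPowerSeries.X 0 : MvPowerSeries (Fin 2) ℚ_[p])) ^ 2 *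
        Sq.subst (MvPowerSeries.X 0 : MvPowerSeries (Fin 2) ℚ_[p]) ^ 2 *
        Sq.subst (MvPowerSeries.X 1 : MvPowerSeries (Fin 2) ℚ_[p]) ^ 2 := by
  obtain ⟨σ₁, h0, h1, hodd, hODE, hSq⟩ := h.exists_sq_eq
  have hθ := thetaLHS_eq_thetaRHS h0 h1 hodd hODE
  have hθ2 : V.thetaLHS σ₁ ^ 2 = V.thetaRHS σ₁ ^ 2 := by rw [hθ]
  unfold thetaLHS thetaRHS at hθ2
  rw [hSq, PowerSeries.subst_pow V.hasSubst_formalGroupLaw, PowerSeries.subst_pow V.hasSubst_formalGroupLawSub,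
    PowerSeries.subst_pow (PowerSeries.HasSubst.X 0), PowerSeries.subst_pow (PowerSeries.HasSubst.X 1)]
  linear_combination hθ2

end Converse

/-! ### §6. At `p = 2`: the squared Mazur–Tate pair EXISTS (uniquely) under the printed fact
`mazurTate_sigmaSq_existsUnique_two`, and `padicSigmaSq` is Silverman's `σ²` -/

section Two

variable (W : WeierstrassCurve ℚ) [W.IsElliptic] [W.IsGloballyMinimal]

/-- **Mazur–Tate 1991 Thm. 3.1 at `p = 2`, differential-equation form, from the printed division-polynomial
form.** Under the fact `mazurTate_sigmaSq_existsUnique_two` (Silverman 2005 §5 Rem. 2), a globally minimal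
`W/ℚ` with good ORDINARY reduction at `2` carries a sigma-squared pair `(Σ, c)` of `W ⊗ ℚ₂`: the
receptacle `IsMazurTateSigmaSqPair` of `PadicSigmaSq.lean` is INHABITED at `p = 2` (whereas
`IsMazurTateSigmaPair` is not when `a₁` is odd, `CanonicalPAdicHeightTwoJunkProofs.lean`).
[Mazur–Tate 1991, Thm. 3.1; Silverman 2005, §5 Rem. 2] [cite: Silverman2005DivPoly, §5 Rem. 2]
[cite: MazurTate1991, Thm. 3.1] -/
theorem exists_isMazurTateSigmaSqPair_two (h : mazurTate_sigmaSq_existsUnique_two)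
    (hgood : W.HasGoodReductionAtPrime 2) (hord : ¬ (2 : ℤ) ∣ W.frobeniusTrace 2) :
    ∃ Sq : ℚ_[2]⟦X⟧, ∃ c : ℚ_[2], (W.baseChange ℚ_[2]).IsMazurTateSigmaSqPair Sq c := by
  obtain ⟨Sq, hSq⟩ := exists_isSigmaSqDivisionSeries_two h W hgood hord
  obtain ⟨c, hc⟩ := hSq.exists_isMazurTateSigmaSqPair
  exact ⟨Sq, c, hc⟩

/-- **THE squared pair `(Σ₂, c₂) = (padicSigmaSq, padicSigmaSqConst)` of `W ⊗ ℚ₂` IS a sigma-squared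
pair** (good ordinary reduction at `2`, under the printed fact): the `p = 2` sigma-squared height
`canonicalPAdicHeightSq W 2` is pinned by a genuine Mazur–Tate `σ²`, not by the junk branch `z²`.
[Silverman 2005, §5 Rem. 2; Mazur–Tate 1991, Thm. 3.1] [cite: Silverman2005DivPoly, §5 Rem. 2] -/
theorem isMazurTateSigmaSqPair_padicSigmaSq_two (h : mazurTate_sigmaSq_existsUnique_two)
    (hgood : W.HasGoodReductionAtPrime 2) (hord : ¬ (2 : ℤ) ∣ W.frobeniusTrace 2) :
    (W.baseChange ℚ_[2]).IsMazurTateSigmaSqPair (W.baseChange ℚ_[2]).padicSigmaSq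
      (W.baseChange ℚ_[2]).padicSigmaSqConst :=
  isMazurTateSigmaSqPair_padicSigmaSq (Or.inr (W.exists_isMazurTateSigmaSqPair_two h hgood hord))

/-- **`padicSigmaSq (W ⊗ ℚ₂)` IS Silverman's `σ² ∈ z² + z³ℤ₂⟦z⟧`**: it satisfies
`σ²(nQ) = σ(Q)^{2n²}F_n²(Q)` for every `n ≥ 1`. [Silverman 2005, §5 Rem. 2; Mazur–Tate 1991, Thm. 3.1]
[cite: Silverman2005DivPoly, §5 Rem. 2] -/
theorem isSigmaSqDivisionSeries_padicSigmaSq_two (h : mazurTate_sigmaSq_existsUnique_two)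
    (hgood : W.HasGoodReductionAtPrime 2) (hord : ¬ (2 : ℤ) ∣ W.frobeniusTrace 2) :
    (W.baseChange ℚ_[2]).IsSigmaSqDivisionSeries (W.baseChange ℚ_[2]).padicSigmaSq :=
  (W.isMazurTateSigmaSqPair_padicSigmaSq_two h hgood hord).isSigmaSqDivisionSeries

variable {W} in
/-- **Uniqueness of the sigma-squared pair at `p = 2`**: any two sigma-squared pairs of `W ⊗ ℚ₂`
coincide (both are sigma-squared division series, unique by the printed fact; the constant is
determined by `Σ`). [Silverman 2005, §5 Rem. 2 («unique»); Mazur–Tate 1991, Thm. 3.1]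
[cite: Silverman2005DivPoly, §5 Rem. 2] -/
theorem IsMazurTateSigmaSqPair.unique_two (h : mazurTate_sigmaSq_existsUnique_two)
    (hgood : W.HasGoodReductionAtPrime 2) (hord : ¬ (2 : ℤ) ∣ W.frobeniusTrace 2) {S₁ S₂ : ℚ_[2]⟦X⟧}
    {c₁ c₂ : ℚ_[2]} (h₁ : (W.baseChange ℚ_[2]).IsMazurTateSigmaSqPair S₁ c₁)
    (h₂ : (W.baseChange ℚ_[2]).IsMazurTateSigmaSqPair S₂ c₂) : S₁ = S₂ ∧ c₁ = c₂ := by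
  obtain rfl : S₁ = S₂ :=
    IsSigmaSqDivisionSeries.unique_two h W hgood hord h₁.isSigmaSqDivisionSeries h₂.isSigmaSqDivisionSeries
  exact ⟨rfl, h₁.ode.const_eq h₂.ode⟩

/-- **`∃!` sigma-squared pair at a good ordinary `p = 2`** — Mazur–Tate 1991 Thm. 3.1 at `p = 2` in the
differential-equation currency of the tree, modulo the printed fact. [Mazur–Tate 1991, Thm. 3.1;
Silverman 2005, §5 Rem. 2] [cite: MazurTate1991, Thm. 3.1] [cite: Silverman2005DivPoly, §5 Rem. 2] -/
theorem existsUnique_isMazurTateSigmaSqPair_two (h : mazurTate_sigmaSq_existsUnique_two)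
    (hgood : W.HasGoodReductionAtPrime 2) (hord : ¬ (2 : ℤ) ∣ W.frobeniusTrace 2) :
    ∃! Sc : ℚ_[2]⟦X⟧ × ℚ_[2], (W.baseChange ℚ_[2]).IsMazurTateSigmaSqPair Sc.1 Sc.2 := by
  obtain ⟨Sq, c, hc⟩ := W.exists_isMazurTateSigmaSqPair_two h hgood hord
  refine ⟨(Sq, c), hc, fun Sc hSc => ?_⟩
  obtain ⟨e1, e2⟩ := hSc.unique_two h hgood hord hc
  exact Prod.ext e1 e2

variable {W} in
/-- **The printed `σ²` is `padicSigmaSq`**: a sigma-squared division series of `W ⊗ ℚ₂` equals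
`(W ⊗ ℚ₂).padicSigmaSq`. [Silverman 2005, §5 Rem. 2] [cite: Silverman2005DivPoly, §5 Rem. 2] -/
theorem IsSigmaSqDivisionSeries.eq_padicSigmaSq_two (h : mazurTate_sigmaSq_existsUnique_two)
    (hgood : W.HasGoodReductionAtPrime 2) (hord : ¬ (2 : ℤ) ∣ W.frobeniusTrace 2) {Sq : ℚ_[2]⟦X⟧}
    (hSq : (W.baseChange ℚ_[2]).IsSigmaSqDivisionSeries Sq) : Sq = (W.baseChange ℚ_[2]).padicSigmaSq :=
  IsSigmaSqDivisionSeries.unique_two h W hgood hord hSq (W.isSigmaSqDivisionSeries_padicSigmaSq_two h hgood hord)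

end Two

end WeierstrassCurve
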